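import Summits.AnomalousDissipation.AnomalousDissipation.Theorems.SawtoothPulseCascadeK1LocalisedCascadeOscillatoryChord

/-!
# K1loc, line `Spectral` — S-D (first good piece): THE EXPONENTIAL SUM OVER A REFINED CHORD

Helper file of the prover lane on the crux `K1LocalisedCascade` (stmt-AnomalousDissipation-19491), route
`SawtoothPulseCascade`, registered line `Cruxes.K1LocalisedCascade.Spectral` (one open stub `stub_highModeConcentration`).
Channel (L) of memo v8 §1/§8, the chord version: given a finite family of pairwise disjoint pieces `[u_i, v_i] ⊆ [0, 1]` of total length
`≤ 1` on each of which the phase `φ` is affine with slope `k_i`, `|k_i| ≥ K₀ > |m|`, up to `E`, with `Σ_i |k_i|⁻¹ ≤ B`, and whose complement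
in `[0, 1]` lies in a set `D`:

* `norm_chord_integral_le` — `‖∫₀¹ sin(2πφ(s)) e^{−2πims} ds‖ ≤ B/(π(1 − |m|/K₀)) + 2πE + |D ∩ [0,1]|`
  (`…OscillatoryChord.norm_integral_sin_phase_mul_exp_le` per piece, the trivial bound on the rest).

WHAT THIS IS NOT: no cascade (the pieces come from `…LineRefineCascade.lineRefine_cascade`). [cite: Grafakos2014, Prop. 3.1.2] [problem: turb]
-/

-- `Summit.<Summit>.<Problem>`: single-conjunct summit, the duplicate namespace segment is deliberate.
set_option linter.dupNamespace false

noncomputable section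

namespace Summit.AnomalousDissipation.AnomalousDissipation.Theorems.SawtoothPulseCascade.K1Start

open Set MeasureTheory intervalIntegral Complex

/-- The integrand of the chord sum has modulus `≤ 1`. [folklore] -/
theorem norm_sin_mul_exp_le (φ : ℝ → ℝ) (m s : ℝ) :
    ‖(Real.sin (2 * Real.pi * φ s) : ℂ) * exp (-(2 * Real.pi * I * (m * s)))‖ ≤ 1 := by
  rw [norm_mul, Complex.norm_real, Complex.norm_exp]
  have h1 : (-(2 * Real.pi * I * (m * s))).re = 0 := by simp
  rw [h1, Real.exp_zero, mul_one, Real.norm_eq_abs]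
  exact Real.abs_sin_le_one _

/-- One piece: `(1/(π|k − m|) + 1/(π|k + m|))/2 ≤ |k|⁻¹/(π(1 − |m|/K₀))` when `|m| < K₀ ≤ |k|`. [folklore] -/
theorem boundary_term_le {k m K₀ : ℝ} (hm : |m| < K₀) (hk : K₀ ≤ |k|) :
    (1 / (Real.pi * |k - m|) + 1 / (Real.pi * |k + m|)) / 2 ≤ |k|⁻¹ / (Real.pi * (1 - |m| / K₀)) := by
  have hπ := Real.pi_pos
  have hK₀ : 0 < K₀ := (abs_nonneg m).trans_lt hm
  have hkpos : 0 < |k| := hK₀.trans_le hk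
  have hθ : 0 < 1 - |m| / K₀ := by rw [sub_pos, div_lt_one hK₀]; exact hm
  have hlow : |k| * (1 - |m| / K₀) ≤ |k| - |m| := by
    rw [mul_sub, mul_one, sub_le_sub_iff_left]
    calc |m| = |m| * 1 := (mul_one _).symm
      _ ≤ |m| * (|k| / K₀) := mul_le_mul_of_nonneg_left ((one_le_div hK₀).mpr hk) (abs_nonneg m)
      _ = |k| * (|m| / K₀) := by ring
  have hpos : 0 < |k| * (1 - |m| / K₀) := mul_pos hkpos hθ
  have e : |k|⁻¹ / (Real.pi * (1 - |m| / K₀)) = 1 / (Real.pi * (|k| * (1 - |m| / K₀))) := by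
    field_simp
  rw [e]
  have h1 : 1 / (Real.pi * |k - m|) ≤ 1 / (Real.pi * (|k| * (1 - |m| / K₀))) := by
    refine one_div_le_one_div_of_le (by positivity) (mul_le_mul_of_nonneg_left ?_ hπ.le)
    exact hlow.trans ((abs_sub_abs_le_abs_sub k m))
  have h2 : 1 / (Real.pi * |k + m|) ≤ 1 / (Real.pi * (|k| * (1 - |m| / K₀))) := by
    refine one_div_le_one_div_of_le (by positivity) (mul_le_mul_of_nonneg_left ?_ hπ.le)
    have := abs_sub_abs_le_abs_sub k (-m)
    rw [abs_neg, sub_neg_eq_add] at this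
    exact hlow.trans this
  linarith

/-- **The exponential sum over a refined chord.**  Let `φ` be continuous, `[u_i, v_i] ⊆ [0, 1]` (`i ∈ S`) pairwise disjoint pieces of total
length `≤ 1` on which `|φ(s′) − φ(s) − k_i(s′ − s)| ≤ E` (`E ≥ 0`), `|k_i| ≥ K₀ > |m|`, `Σ_i |k_i|⁻¹ ≤ B`, and suppose every `s ∈ [0, 1]`
outside the pieces lies in `D`.  Then `‖∫₀¹ sin(2πφ(s)) e^{−2πims} ds‖ ≤ B/(π(1 − |m|/K₀)) + 2πE + |D ∩ [0, 1]|`.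
[cite: Grafakos2014, Prop. 3.1.2] -/
theorem norm_chord_integral_le {φ : ℝ → ℝ} (hφ : Continuous φ) {m : ℝ} {ι : Type*} (S : Finset ι) (u v k : ι → ℝ)
    {E K₀ B : ℝ} (hE : 0 ≤ E) (hm : |m| < K₀)
    (hpiece : ∀ i ∈ S, u i ≤ v i ∧ Icc (u i) (v i) ⊆ Icc (0 : ℝ) 1)
    (hdisj : ∀ i ∈ S, ∀ i' ∈ S, i ≠ i' → Disjoint (Icc (u i) (v i)) (Icc (u i') (v i')))
    (hlen : ∑ i ∈ S, (v i - u i) ≤ 1)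
    (haff : ∀ i ∈ S, ∀ s ∈ Icc (u i) (v i), ∀ s' ∈ Icc (u i) (v i), |φ s' - φ s - k i * (s' - s)| ≤ E)
    (hk : ∀ i ∈ S, K₀ ≤ |k i|) (hB : ∑ i ∈ S, |k i|⁻¹ ≤ B) (D : Set ℝ)
    (hcover : ∀ s ∈ Icc (0 : ℝ) 1, (∃ i ∈ S, s ∈ Icc (u i) (v i)) ∨ s ∈ D) :
    ‖∫ s in (0 : ℝ)..1, (Real.sin (2 * Real.pi * φ s) : ℂ) * exp (-(2 * Real.pi * I * (m * s)))‖ ≤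
      B / (Real.pi * (1 - |m| / K₀)) + 2 * Real.pi * E + (volume (D ∩ Icc (0 : ℝ) 1)).toReal := by
  have hπ := Real.pi_pos
  have hK₀ : 0 < K₀ := (abs_nonneg m).trans_lt hm
  have hθ : 0 < 1 - |m| / K₀ := by rw [sub_pos, div_lt_one hK₀]; exact hm
  set F : ℝ → ℂ := fun s => (Real.sin (2 * Real.pi * φ s) : ℂ) * exp (-(2 * Real.pi * I * (m * s))) with hF
  have hFc : Continuous F := by
    refine Continuous.mul (Complex.continuous_ofReal.comp (Real.continuous_sin.comp (continuous_const.mul hφ))) ?_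
    fun_prop
  have hF1 : ∀ s, ‖F s‖ ≤ 1 := fun s => norm_sin_mul_exp_le φ m s
  have hFi : ∀ A : Set ℝ, volume A < ⊤ → IntegrableOn F A volume := fun A hA =>
    Measure.integrableOn_of_bounded (M := 1) hA.ne hFc.aestronglyMeasurable (Filter.Eventually.of_forall hF1)
  -- the pieces and their union
  set U : Set ℝ := ⋃ i ∈ S, Icc (u i) (v i) with hU
  have hUmeas : MeasurableSet U := Finset.measurableSet_biUnion S fun i _ => measurableSet_Icc
  have hUsub : U ⊆ Icc 0 1 := iUnion₂_subset fun i hi => (hpiece i hi).2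
  have hvol1 : volume (Icc (0 : ℝ) 1) < ⊤ := by rw [Real.volume_Icc]; exact ENNReal.ofReal_lt_top
  -- split the integral
  have hsplit : ∫ s in (0 : ℝ)..1, F s = (∑ i ∈ S, ∫ s in (u i)..(v i), F s) + ∫ s in Icc 0 1 \ U, F s := by
    rw [intervalIntegral.integral_of_le zero_le_one, ← integral_Icc_eq_integral_Ioc,
      setIntegral_sdiff hUmeas (hFi _ hvol1) hUsub, hU,
      integral_biUnion_finset S (fun i _ => measurableSet_Icc) (fun i hi i' hi' hne => hdisj i hi i' hi' hne)
        (fun i _ => hFi _ (by rw [Real.volume_Icc]; exact ENNReal.ofReal_lt_top))]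
    have : ∀ i ∈ S, ∫ s in Icc (u i) (v i), F s = ∫ s in (u i)..(v i), F s := fun i hi => by
      rw [integral_Icc_eq_integral_Ioc, intervalIntegral.integral_of_le (hpiece i hi).1]
    rw [Finset.sum_congr rfl this]; ring
  -- each piece
  have hleaf : ∀ i ∈ S, ‖∫ s in (u i)..(v i), F s‖ ≤ |k i|⁻¹ / (Real.pi * (1 - |m| / K₀)) + 2 * Real.pi * E * (v i - u i) := by
    intro i hi
    have hki : K₀ ≤ |k i| := hk i hi
    have hkm : k i ≠ m := fun h => by rw [h] at hki; exact absurd hki (not_le.mpr hm)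
    have hkm' : k i ≠ -m := fun h => by rw [h, abs_neg] at hki; exact absurd hki (not_le.mpr hm)
    have hε : ∀ s ∈ Icc (u i) (v i), |φ s - (k i * s + (φ (u i) - k i * u i))| ≤ E := by
      intro s hs
      have h := haff i hi (u i) (left_mem_Icc.mpr (hpiece i hi).1) s hs
      rwa [show φ s - (k i * s + (φ (u i) - k i * u i)) = φ s - φ (u i) - k i * (s - u i) by ring]
    exact (norm_integral_sin_phase_mul_exp_le hφ (hpiece i hi).1 hkm hkm' hε).trans
      (by linarith [boundary_term_le hm hki])
  -- the rest
  have hrest : ‖∫ s in Icc 0 1 \ U, F s‖ ≤ (volume (D ∩ Icc (0 : ℝ) 1)).toReal := by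
    have hsub : Icc 0 1 \ U ⊆ D ∩ Icc 0 1 := by
      intro s hs
      refine ⟨?_, hs.1⟩
      rcases hcover s hs.1 with ⟨i, hi, hsi⟩ | hD
      · exact absurd (mem_iUnion₂.mpr ⟨i, hi, hsi⟩) hs.2
      · exact hD
    have hlt : volume (Icc (0 : ℝ) 1 \ U) < ⊤ := lt_of_le_of_lt (measure_mono sdiff_subset) hvol1
    refine (norm_setIntegral_le_of_norm_le_const hlt fun s _ => hF1 s).trans ?_
    rw [one_mul]
    exact ENNReal.toReal_mono (lt_of_le_of_lt (measure_mono inter_subset_right) hvol1).ne (measure_mono hsub)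
  -- sum up
  rw [hsplit]
  calc ‖(∑ i ∈ S, ∫ s in (u i)..(v i), F s) + ∫ s in Icc 0 1 \ U, F s‖
      ≤ ∑ i ∈ S, ‖∫ s in (u i)..(v i), F s‖ + ‖∫ s in Icc 0 1 \ U, F s‖ :=
        (norm_add_le _ _).trans (add_le_add (norm_sum_le _ _) le_rfl)
    _ ≤ ∑ i ∈ S, (|k i|⁻¹ / (Real.pi * (1 - |m| / K₀)) + 2 * Real.pi * E * (v i - u i)) +
          (volume (D ∩ Icc (0 : ℝ) 1)).toReal := by
        gcongr with i hi
        exact hleaf i hi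
    _ = (∑ i ∈ S, |k i|⁻¹) / (Real.pi * (1 - |m| / K₀)) + 2 * Real.pi * E * ∑ i ∈ S, (v i - u i) +
          (volume (D ∩ Icc (0 : ℝ) 1)).toReal := by
        rw [Finset.sum_add_distrib, Finset.sum_div, Finset.mul_sum]
    _ ≤ B / (Real.pi * (1 - |m| / K₀)) + 2 * Real.pi * E * 1 + (volume (D ∩ Icc (0 : ℝ) 1)).toReal := by
        gcongr
    _ = _ := by rw [mul_one]

end Summit.AnomalousDissipation.AnomalousDissipation.Theorems.SawtoothPulseCascade.K1Start
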